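import Mathlib.Analysis.SpecialFunctions.Complex.Log
import Mathlib.FieldTheory.IntermediateField.Adjoin.Basic
import Mathlib.RingTheory.AlgebraicIndependent.Transcendental
import Literature.ModelTheory.ExponentialFields.ExponentialField
import Literature.NumberTheory.Transcendental.ZilberField
import HarnessLib

/-!
# Named fact: Schanuel's conjecture is equivalent to its restriction to `ecl(∅)`

Grounder file (D-0014 named facts) for the routes `Schanuel/EclCore` (assembly item
stmt-Schanuel-0408, hypothesis requested as definition-demand `schanuelConjecture_iff_ecl_empty`,
wi-03870) and `Schanuel/Zilber` (crux #3).

Kirby (Bull. LMS 42 (2010), arXiv:0810.4285): every counterexample `ā` to Schanuel's conjecture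
(`δ(ā) = td(ā, e^{ā}) − ldim_ℚ ā < 0`) contains an *essential* counterexample in its `ℚ`-linear
span (§1, before Thm. 1.4), and every essential counterexample lies in `ecl^ℂ(∅)` (Prop. 7.2,
proved from the relative Schanuel theorem 1.2 — in the tree as the fact
`Literature.NumberTheory.Transcendental.kirby_relative_schanuel_complex`). Hence Schanuel's conjecture for `ℂ_exp` holds iff it
holds for all `ℚ`-linearly independent tuples with entries in `ecl(∅)` (`Literature.ecl ∅`, Kirby's
exponential-algebraic closure of `∅`; a countable set, Kirby Remark 3.4).

The Problems-layer statement `Literature.Periods.SchanuelConjecture` (= root `Schanuel`) cannot be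
imported into Literature; it unfolds by `Iff.rfl` to `Literature.SchanuelProperty ℂ`
(`Complex.exp = ExponentialRing.exp` on `ℂ` definitionally), which is what is used here.

Nothing is asserted; users take `(h : Literature.Periods.schanuelConjecture_iff_ecl_empty)`.

## References

* J. Kirby, *Exponential algebraicity in exponential fields*, Bull. London Math. Soc. 42 (2010),
  879–890: §1 (essential counterexamples), Thm. 1.2, Prop. 7.2, Remark 3.4.
* J. Ax, Ann. of Math. 93 (1971), Thm. 3.
-/

noncomputable section

namespace Literature.NumberTheory.Transcendental

/-- NAMED FACT (Kirby 2010, Prop. 7.2 with §1: "if `ā` is an essential counterexample to the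
Schanuel property then `ā` is contained in `ecl^F(∅)`", and "every counterexample contains an
essential counterexample in its `ℚ`-linear span"). The Schanuel property of `ℂ_exp`
(`SchanuelProperty ℂ`, to which `Periods.SchanuelConjecture`/`Schanuel` unfold by `Iff.rfl`)
holds iff it holds for every `ℚ`-linearly independent tuple with all entries in `ecl(∅)`.
Users take `(h : schanuelConjecture_iff_ecl_empty)`. [cite: Kirby2010, Prop. 7.2 and §1] -/
def schanuelConjecture_iff_ecl_empty : Prop :=
  Literature.ModelTheory.ExponentialFields.SchanuelProperty ℂ ↔
    ∀ (n : ℕ) (x : Fin n → ℂ), (∀ i, x i ∈ ecl (∅ : Set ℂ)) → LinearIndependent ℚ x →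
      (n : Cardinal) ≤ Algebra.trdeg ℚ
        ↥(IntermediateField.adjoin ℚ (Set.range x ∪ Set.range (Complex.exp ∘ x)))

end Literature.NumberTheory.Transcendental

end
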